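import Literature.IUT.HodgeTheaters.PuncturedEllipticCoveringsRmk121Proofs
import Literature.IUT.HodgeTheaters.PuncturedEllipticArrowModelUnorientedModLCuspLaws
import Literature.IUT.HodgeTheaters.PuncturedEllipticArrowModelTheta
import HarnessLib

/-!
# The [IUTchI] Remark 1.2.1 CLOSERS fired at the §1 model data (F-2588 instance-form non-vacuity) — proof-only

Mochizuki, *Inter-universal Teichmüller theory I*, kurims manuscript (May 2020), §1, Remark 1.2.1, p. 40
([IUTchI] Rmk 1.2.1 p.40) [claim: Mochizuki2012, status: disputed], as printed: "It follows immediately from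
Corollary 1.2 that `Aut_k(X̲→) = Gal(X̲→/C̲) (≅ ℤ/2lℤ)`; `Aut_k(C̲→) = Gal(C̲→/C̲) (≅ ℤ/lℤ)`" — typed by
abc-iut-L5-t1 as the predicate `PuncturedEllipticData.Rmk121` (FACT-LIST row F-2588).

PROOF-ONLY companion (abc-iut cell, layer L5, row «F-2588-RMK121-INSTANCE» of abc-iut-L5-lead g8's L5 ROWS
03:27Z; seat abc-iut-w6-d067 gen 8).  No definition, no instance, nothing restated.  abc-iut-L5-d4's
instance-form CLOSERS of the Remark (`PuncturedEllipticCoveringsRmk121Proofs`, this file's own route of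
record there),

* `ArrowCoveringClaims.rmk121 (h : D.ArrowCoveringClaims) (C : D.CuspGalois) (hX : [Π_X : Π_X̲] = l) : D.Rmk121`,
* `ArrowCoveringClaims.rmk121_of_card (h) (C) (hcard : #Cusp(X̲) = l) : D.Rmk121`,

take THREE binders: the printed claims of pp. 37–38 (`ArrowCoveringClaims`, F-2586), the companion cusp
action (`CuspGalois`) and the Def. 3.1 (d) numeric `[Π_X : Π_X̲] = l` / `#Cusp(X̲) = l`.  Here the closers are
FIRED — every binder supplied BY NAME by a landed theorem — at EVERY §1 model datum the tree holds:

1. abc-iut-L5-t1's finite arrow model `ArrowModel.datum l h5 h6` (`Π_C = N ⋊ D_l`, `G_k = 1`;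
   `arrowCoveringClaims`, `cuspGalois`, `thetaNumerics`);
2. the unoriented model `ArrowModel.udatum l h5 h6` (`udatum_arrowCoveringClaims`, `udatumCuspGalois`,
   `udatum_numerics`);
3. the lifted model `ArrowModel.pedOf Γ l h5 h6` over an arbitrary profinite `Γ = G_k`
   (`pedOf_arrowCoveringClaims`, `liftCuspGalois`, `pedOf_numerics`);
4. the `K`-level datum `(ArrowModel.geometryOf G_K l hGK h5 h6).pe` of the `ThetaGeometry` built on it.

So the binder triple of the F-2588 closer is JOINTLY INHABITED in kernel (for every prime-to-6 `l ≥ 5`,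
resp. every compact totally disconnected `Γ`): per datum a `rmk121_closer_inputs_…` conjunction and an
`exists_rmk121_closer_fires…` record whose `Rmk121` component is OBTAINED BY FIRING the closer (the bare
propositions `Rmk121 (datum …)` / `(udatum …)` / `(pedOf …)` are abc-iut-L5-t1's landed direct proofs
`ArrowModel.rmk121`, `udatum_rmk121`, `pedOf_rmk121` and are NOT restated — gate dedup rule; by proof
irrelevance the closer's output is that same proposition).  Also fired: the cusp count `#Cusp(X̲) = l`
(`CuspGalois.card_cusp` ∘ numerics) and the pigeonhole step `CuspGalois.exists_pow_act_not_mem_triple`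
("some Galois translate of a cusp leaves `{ε⁰, ε′, ε″}`") at the arrow model, and (§5) the full p448117 route
`CuspGalois + ModLCuspLaws + ι̲ ⟹ ArrowCoveringClaims ⟹ Rmk121` (abc-iut-L5-t1's
`CuspGalois.arrowCoveringClaims_of_modLCuspLaws` composed with `rmk121_of_card`) at the arrow and unoriented models.

HONEST LABEL: a model fires OUR closer on OUR typed binders (consistency / non-vacuity evidence for the
instance form of F-2588); it is not the fundamental group of a curve and asserts nothing about print.  No side
is taken on [IUTchIII] Cor. 3.12; typed ≠ proved for the [IUTchI] claim keys.
-/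

namespace Literature.IUT.HodgeTheaters

namespace PuncturedEllipticData

namespace ArrowModel

/-! ### 1. The finite arrow model `datum l h5 h6` -/

section Datum

variable {l : ℕ} (h5 : 5 ≤ l) (h6 : Nat.Coprime l 6)

/-- **`#Cusp(X̲) = l` at the arrow model**: abc-iut-L5-t1's `CuspGalois.card_cusp` (`#Cusp = [Π_X : Π_X̲]`)
composed with the model's Def. 3.1 (d) numeric `[Π_X : Π_X̲] = l`.
([IUTchI] §1 p.37) [claim: Mochizuki2012, status: disputed] -/
theorem card_cusp_datum : Nat.card (datum l h5 h6).Cusp = (datum l h5 h6).l :=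
  (cuspGalois h5 h6).card_cusp.trans (thetaNumerics h5 h6).1

/-- **The three binders of the F-2588 closer are JOINTLY supplied at the arrow model** —
`ArrowCoveringClaims` (`arrowCoveringClaims`), a `CuspGalois` structure (`cuspGalois`) and the Def. 3.1 (d)
numeric in both spellings (`[Π_X : Π_X̲] = l` from `thetaNumerics`, `#Cusp(X̲) = l` from `card_cusp_datum`);
hence `ArrowCoveringClaims.rmk121` / `….rmk121_of_card` FIRE there (their output `Rmk121 (datum l h5 h6)` is
abc-iut-L5-t1's landed `ArrowModel.rmk121`, not restated here — see the records below, whose `Rmk121`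
component IS the closer's output). ([IUTchI] Rmk 1.2.1 p.40) [claim: Mochizuki2012, status: disputed] -/
theorem rmk121_closer_inputs_datum :
    (datum l h5 h6).ArrowCoveringClaims ∧ Nonempty (datum l h5 h6).CuspGalois ∧
      (datum l h5 h6).PiXbar.relIndex (datum l h5 h6).PiX = (datum l h5 h6).l ∧
      Nat.card (datum l h5 h6).Cusp = (datum l h5 h6).l :=
  ⟨arrowCoveringClaims h5 h6, ⟨cuspGalois h5 h6⟩, (thetaNumerics h5 h6).1, card_cusp_datum h5 h6⟩

/-- **The pigeonhole step of the closer FIRES at the arrow model**: for `g ∈ Π_X ∖ Π_X̲` and any cusp `x`,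
some Galois translate `g^k · x` lies outside `{ε⁰, ε′, ε″}` (abc-iut-L5-d4's
`CuspGalois.exists_pow_act_not_mem_triple`, its index hypothesis supplied by `thetaNumerics`).
([IUTchI] Rmk 1.2.1 p.40) [claim: Mochizuki2012, status: disputed] -/
theorem exists_pow_act_not_mem_triple_datum {g : (datum l h5 h6).PiC} (hg : g ∈ (datum l h5 h6).PiX)
    (hgb : g ∉ (datum l h5 h6).PiXbar) (x : (datum l h5 h6).Cusp) :
    ∃ k : ℕ, (cuspGalois h5 h6).act (g ^ k) x ∉
      ({(datum l h5 h6).ε0, (datum l h5 h6).ε1, (datum l h5 h6).ε2} : Set (datum l h5 h6).Cusp) :=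
  (cuspGalois h5 h6).exists_pow_act_not_mem_triple (thetaNumerics h5 h6).1 hg hgb x

/-- **Joint inhabitation record at the arrow model**: for every `l ≥ 5` prime to `6` there is a §1 datum with
that `l` at which the three binders of the F-2588 closer hold TOGETHER — `ArrowCoveringClaims`, a `CuspGalois`
structure, `#Cusp(X̲) = l` — and `Rmk121` obtained there BY FIRING the closer `rmk121_of_card` on them.
([IUTchI] Rmk 1.2.1 p.40) [claim: Mochizuki2012, status: disputed] -/
theorem exists_rmk121_closer_fires (l : ℕ) (h5 : 5 ≤ l) (h6 : Nat.Coprime l 6) :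
    ∃ D : PuncturedEllipticData.{0}, D.l = l ∧ D.ArrowCoveringClaims ∧
      Nonempty D.CuspGalois ∧ Nat.card D.Cusp = D.l ∧ D.PiXbar.relIndex D.PiX = D.l ∧ D.Rmk121 :=
  ⟨datum l h5 h6, rfl, arrowCoveringClaims h5 h6, ⟨cuspGalois h5 h6⟩, card_cusp_datum h5 h6,
    (thetaNumerics h5 h6).1,
    -- the closer FIRES: `Rmk121` obtained from the three binders, not from the direct proof
    (arrowCoveringClaims h5 h6).rmk121_of_card (cuspGalois h5 h6) (card_cusp_datum h5 h6)⟩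

/-- Instance at `l = 5`. ([IUTchI] Rmk 1.2.1 p.40) [claim: Mochizuki2012, status: disputed] -/
theorem exists_rmk121_closer_fires_five :
    ∃ D : PuncturedEllipticData.{0}, D.l = 5 ∧ D.ArrowCoveringClaims ∧
      Nonempty D.CuspGalois ∧ Nat.card D.Cusp = D.l ∧ D.PiXbar.relIndex D.PiX = D.l ∧ D.Rmk121 :=
  exists_rmk121_closer_fires 5 le_rfl (by decide)

end Datum

/-! ### 2. The unoriented model `udatum l h5 h6` -/

section UDatum

variable {l : ℕ} (h5 : 5 ≤ l) (h6 : Nat.Coprime l 6)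

/-- `#Cusp(X̲) = l` at the unoriented model. ([IUTchI] §1 p.37) [claim: Mochizuki2012, status: disputed] -/
theorem card_cusp_udatum : Nat.card (udatum l h5 h6).Cusp = (udatum l h5 h6).l :=
  (udatumCuspGalois h5 h6).card_cusp.trans (udatum_numerics h5 h6).1

/-- **The three binders of the F-2588 closer are JOINTLY supplied at the unoriented model**
(`udatum_arrowCoveringClaims`, `udatumCuspGalois`, `udatum_numerics` / `card_cusp_udatum`).
([IUTchI] Rmk 1.2.1 p.40) [claim: Mochizuki2012, status: disputed] -/
theorem rmk121_closer_inputs_udatum :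
    (udatum l h5 h6).ArrowCoveringClaims ∧ Nonempty (udatum l h5 h6).CuspGalois ∧
      (udatum l h5 h6).PiXbar.relIndex (udatum l h5 h6).PiX = (udatum l h5 h6).l ∧
      Nat.card (udatum l h5 h6).Cusp = (udatum l h5 h6).l :=
  ⟨udatum_arrowCoveringClaims h5 h6, ⟨udatumCuspGalois h5 h6⟩, (udatum_numerics h5 h6).1, card_cusp_udatum h5 h6⟩

/-- **Joint inhabitation record at the unoriented model**, `Rmk121` obtained BY FIRING the closer
`ArrowCoveringClaims.rmk121` on the three binders. ([IUTchI] Rmk 1.2.1 p.40) [claim: Mochizuki2012, status: disputed] -/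
theorem exists_rmk121_closer_fires_udatum (l : ℕ) (h5 : 5 ≤ l) (h6 : Nat.Coprime l 6) :
    ∃ D : PuncturedEllipticData.{0}, D.l = l ∧ D.ArrowCoveringClaims ∧ Nonempty D.CuspGalois ∧
      Nat.card D.Cusp = D.l ∧ D.Rmk121 ∧ D = udatum l h5 h6 :=
  ⟨udatum l h5 h6, rfl, udatum_arrowCoveringClaims h5 h6, ⟨udatumCuspGalois h5 h6⟩, card_cusp_udatum h5 h6,
    (udatum_arrowCoveringClaims h5 h6).rmk121 (udatumCuspGalois h5 h6) (udatum_numerics h5 h6).1, rfl⟩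

end UDatum

/-! ### 3. The lifted model `pedOf Γ l h5 h6` over an arbitrary profinite `Γ = G_k` -/

section Lift

variable (Γ : Type) [Group Γ] [TopologicalSpace Γ] [IsTopologicalGroup Γ] [CompactSpace Γ]
  [TotallyDisconnectedSpace Γ] (l : ℕ) [NeZero l] (h5 : 5 ≤ l) (h6 : Nat.Coprime l 6)

/-- `#Cusp(X̲) = l` at the lifted model. ([IUTchI] §1 p.37) [claim: Mochizuki2012, status: disputed] -/
theorem card_cusp_pedOf : Nat.card (pedOf Γ l h5 h6).Cusp = (pedOf Γ l h5 h6).l :=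
  (liftCuspGalois Γ l h5 h6).card_cusp.trans (pedOf_numerics Γ l h5 h6).1

/-- **The three binders of the F-2588 closer are JOINTLY supplied at the lifted model** `Π_C = Γ × (N ⋊ D_l)`
for EVERY compact totally disconnected `Γ` (`pedOf_arrowCoveringClaims`, `liftCuspGalois`, `pedOf_numerics` /
`card_cusp_pedOf`); the closer's output there is abc-iut-L5-t1's landed `pedOf_rmk121` (not restated).
([IUTchI] Rmk 1.2.1 p.40) [claim: Mochizuki2012, status: disputed] -/
theorem rmk121_closer_inputs_pedOf :
    (pedOf Γ l h5 h6).ArrowCoveringClaims ∧ Nonempty (pedOf Γ l h5 h6).CuspGalois ∧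
      (pedOf Γ l h5 h6).PiXbar.relIndex (pedOf Γ l h5 h6).PiX = (pedOf Γ l h5 h6).l ∧
      Nat.card (pedOf Γ l h5 h6).Cusp = (pedOf Γ l h5 h6).l :=
  ⟨pedOf_arrowCoveringClaims Γ l h5 h6, ⟨liftCuspGalois Γ l h5 h6⟩, (pedOf_numerics Γ l h5 h6).1,
    card_cusp_pedOf Γ l h5 h6⟩

/-- **Joint inhabitation record at the lifted model** over `Γ`, `Rmk121` obtained BY FIRING the closer
`ArrowCoveringClaims.rmk121_of_card`. ([IUTchI] Rmk 1.2.1 p.40) [claim: Mochizuki2012, status: disputed] -/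
theorem exists_rmk121_closer_fires_pedOf :
    ∃ D : PuncturedEllipticData.{0}, D.l = l ∧ D.ArrowCoveringClaims ∧ Nonempty D.CuspGalois ∧
      Nat.card D.Cusp = D.l ∧ D.Rmk121 ∧ D = pedOf Γ l h5 h6 :=
  ⟨pedOf Γ l h5 h6, rfl, pedOf_arrowCoveringClaims Γ l h5 h6, ⟨liftCuspGalois Γ l h5 h6⟩,
    card_cusp_pedOf Γ l h5 h6,
    (pedOf_arrowCoveringClaims Γ l h5 h6).rmk121_of_card (liftCuspGalois Γ l h5 h6) (card_cusp_pedOf Γ l h5 h6),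
    rfl⟩

end Lift

/-! ### 4. The `K`-level datum of the `ThetaGeometry` built on the lifted model -/

section Theta

variable {GF : Type} [Group GF] [TopologicalSpace GF] [IsTopologicalGroup GF] [CompactSpace GF]
  [TotallyDisconnectedSpace GF] (GK : Subgroup GF) (l : ℕ) [NeZero l]

/-- **The F-2588 closer FIRES at the `K`-level §1 datum `(geometryOf G_K l).pe`** of abc-iut-L5-t1's
`ThetaGeometry G_F G_K l` (that datum IS `pedOf G_K l`, by construction).
([IUTchI] Rmk 1.2.1 p.40) [claim: Mochizuki2012, status: disputed] -/
theorem rmk121_of_claims_geometryOf (hGK : IsClosed (GK : Set GF)) (h5 : 5 ≤ l) (h6 : Nat.Coprime l 6) :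
    (geometryOf GK l hGK h5 h6).pe.Rmk121 :=
  haveI : CompactSpace GK := isCompact_iff_compactSpace.mp hGK.isCompact
  (pedOf_arrowCoveringClaims GK l h5 h6).rmk121_of_card (liftCuspGalois GK l h5 h6) (card_cusp_pedOf GK l h5 h6)

/-- **Joint inhabitation record over a `ThetaGeometry`**: for every closed `G_K ≤ G_F` (compact totally
disconnected) and every `l ≥ 5` prime to `6` there is a `ThetaGeometry G_F G_K l` at whose `K`-level datum
the three binders of the F-2588 closer hold together and the closer yields `Rmk121`.
([IUTchI] Rmk 1.2.1 p.40) [claim: Mochizuki2012, status: disputed] -/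
theorem exists_thetaGeometry_rmk121_closer_fires (hGK : IsClosed (GK : Set GF)) (h5 : 5 ≤ l)
    (h6 : Nat.Coprime l 6) :
    ∃ geom : ThetaGeometry GF GK l, geom.pe.ArrowCoveringClaims ∧ Nonempty geom.pe.CuspGalois ∧
      Nat.card geom.pe.Cusp = geom.pe.l ∧ geom.pe.PiXbar.relIndex geom.pe.PiX = geom.pe.l ∧ geom.pe.Rmk121 :=
  haveI : CompactSpace GK := isCompact_iff_compactSpace.mp hGK.isCompact
  ⟨geometryOf GK l hGK h5 h6, pedOf_arrowCoveringClaims GK l h5 h6, ⟨liftCuspGalois GK l h5 h6⟩,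
    card_cusp_pedOf GK l h5 h6, (pedOf_numerics GK l h5 h6).1, rmk121_of_claims_geometryOf GK l hGK h5 h6⟩

end Theta

/-! ### 5. The p448117 route: `Rmk121` from {`CuspGalois`, `ModLCuspLaws`, `ι̲`, `#Cusp = l`} alone -/

section Laws

variable (l : ℕ) (h5 : 5 ≤ l) (h6 : Nat.Coprime l 6)

/-- **The full «hA re-grounding» chain FIRES at the arrow model**: from the cusp action, the six `Δ_ε`-level laws
`ModLCuspLaws` (abc-iut-L5-t1's `ArrowModel.modLCuspLaws`), an element `ι̲ ∈ Δ_C̲ ∖ Δ_X̲` (`exists_iota`) and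
`#Cusp(X̲) = l`, abc-iut-L5-t1's p448117 `CuspGalois.arrowCoveringClaims_of_modLCuspLaws` yields `ArrowCoveringClaims`
and then abc-iut-L5-d4's `ArrowCoveringClaims.rmk121_of_card` yields `Rmk121` — both closers composed, every input
supplied BY NAME. ([IUTchI] Rmk 1.2.1 p.40) [claim: Mochizuki2012, status: disputed] -/
theorem exists_rmk121_closer_fires_of_laws :
    ∃ D : PuncturedEllipticData.{0}, D.l = l ∧ Nonempty D.CuspGalois ∧ D.ModLCuspLaws ∧
      (∃ c ∈ D.DeltaCbar, c ∉ D.DeltaXbar) ∧ Nat.card D.Cusp = D.l ∧ D.ArrowCoveringClaims ∧ D.Rmk121 ∧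
      D = datum l h5 h6 :=
  ⟨datum l h5 h6, rfl, ⟨cuspGalois h5 h6⟩, modLCuspLaws h5 h6, exists_iota h5 h6, card_cusp_datum h5 h6,
    (cuspGalois h5 h6).arrowCoveringClaims_of_modLCuspLaws (modLCuspLaws h5 h6) (exists_iota h5 h6),
    ((cuspGalois h5 h6).arrowCoveringClaims_of_modLCuspLaws (modLCuspLaws h5 h6)
      (exists_iota h5 h6)).rmk121_of_card (cuspGalois h5 h6) (card_cusp_datum h5 h6), rfl⟩

/-- The same chain at the unoriented model (`udatumCuspGalois`, `modLCuspLaws_udatum`, `udatum_exists_iota`,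
`card_cusp_udatum`). ([IUTchI] Rmk 1.2.1 p.40) [claim: Mochizuki2012, status: disputed] -/
theorem exists_rmk121_closer_fires_of_laws_udatum :
    ∃ D : PuncturedEllipticData.{0}, D.l = l ∧ Nonempty D.CuspGalois ∧ D.ModLCuspLaws ∧
      (∃ c ∈ D.DeltaCbar, c ∉ D.DeltaXbar) ∧ Nat.card D.Cusp = D.l ∧ D.ArrowCoveringClaims ∧ D.Rmk121 ∧
      D = udatum l h5 h6 :=
  ⟨udatum l h5 h6, rfl, ⟨udatumCuspGalois h5 h6⟩, modLCuspLaws_udatum h5 h6, udatum_exists_iota h5 h6,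
    card_cusp_udatum h5 h6, udatum_arrowCoveringClaims_of_laws h5 h6,
    (udatum_arrowCoveringClaims_of_laws h5 h6).rmk121_of_card (udatumCuspGalois h5 h6) (card_cusp_udatum h5 h6),
    rfl⟩

end Laws

end ArrowModel

end PuncturedEllipticData

end Literature.IUT.HodgeTheaters
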